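import Summits.AtomisticToContinuum.BoseEinsteinCondensation.Theorems.BECInsertionCorrectorStaticResponseBoundModulationRealForm
import HarnessLib

/-!
# Modulated minimisers on the torus, II: (a) the weak Euler–Lagrange equation and (b) the
# ground-state representation from minimality (support for stub S3 `ModulationBootstrap`,
# item stmt-AtomisticToContinuum-12057)

Part 2 of 5. For a positive real finite-energy MINIMISER `Φ` of `Ψ ↦ E_w(Ψ) + s⟨∑ⱼcos(p·xⱼ)⟩_Ψ`
over finite-energy periodic trial states (value `λ`):
(a) `eulerLagrange_of_isMinimiser` — `∫∇|Φ|·∇(ζ|Φ|) + ∫Wζ|Φ|² + s∫(∑cos)ζ|Φ|² = λ∫ζ|Φ|²` for real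
`C¹` lattice-periodic Bose-symmetric `ζ` (first variation along `(1+εζ)Φ/‖·‖`);
(b) `gsRepresentation_of_isMinimiser` — `E_w(θ|Φ|) + s⟨∑cos⟩ = λ + ∫|∇θ|²|Φ|²` for normalised
`θ|Φ|` (Davies' ground-state transform, `C¹` version: `|∇(θF)|² = ∇F·∇(θ²F) + |∇θ|²F²` and (a)
with `ζ = θ²`); `gsRepresentation_of_real` — `θ = |Ψ|/|Φ|` for any real nonnegative `Ψ`.

References: [ReedSimonIV1978] §XIII.1; [Davies1989] §4.2 Thm 4.2.1.
-/

noncomputable section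

namespace Summit.AtomisticToContinuum.BoseEinsteinCondensation.Cruxes.StaticResponseBound.UvThomsonForceWave

open MeasureTheory Filter Metric
open scoped ENNReal NNReal BigOperators Topology
open Literature.MathematicalPhysics.QuantumManyBody.BoseGas
open Summit.AtomisticToContinuum.BoseEinsteinCondensation.Theses.BECInsertionCorrector
open Summit.AtomisticToContinuum.BoseEinsteinCondensation.Theorems.StaticResponseBound.Negative

variable {N : ℕ} {L : ℝ}

/-! ### An elementary lemma: a quadratic `2εx + ε²y ≥ 0` for all small `ε` forces `x = 0` -/

/-- If `0 ≤ 2εx + ε²y` for all `|ε| < ε₀` (`ε₀ > 0`), then `x = 0`. [folklore] -/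
theorem eq_zero_of_forall_small_quadratic_nonneg {x y ε₀ : ℝ} (hε₀ : 0 < ε₀)
    (h : ∀ ε : ℝ, |ε| < ε₀ → 0 ≤ 2 * ε * x + ε ^ 2 * y) : x = 0 := by
  by_contra hx
  have hxpos : 0 < |x| := abs_pos.2 hx
  set t : ℝ := min (ε₀ / 2) (|x| / (|y| + 1)) with ht
  have htpos : 0 < t := lt_min (by linarith) (by positivity)
  have htε : t < ε₀ := (min_le_left _ _).trans_lt (by linarith)
  have hty : t * |y| < |x| := by
    have h1 : t ≤ |x| / (|y| + 1) := min_le_right _ _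
    have h2 : |x| / (|y| + 1) * |y| < |x| := by
      rw [div_mul_eq_mul_div, div_lt_iff₀ (by positivity)]; nlinarith
    nlinarith [abs_nonneg y]
  have hp := h t (by rwa [abs_of_pos htpos])
  have hm := h (-t) (by rwa [abs_neg, abs_of_pos htpos])
  -- `2t|x| ≤ t² y ≤ t² |y|`, contradiction with `t|y| < |x|`
  have hle : 2 * t * |x| ≤ t ^ 2 * |y| := by
    rcases le_or_gt 0 x with hx0 | hx0
    · rw [abs_of_nonneg hx0]; nlinarith [le_abs_self y]
    · rw [abs_of_neg hx0]; nlinarith [le_abs_self y]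
  nlinarith

/-! ### (a) The weak Euler–Lagrange equation of a positive minimiser -/

section EulerLagrange

variable {w : ℝ → ℝ≥0∞} {Φ : PeriodicTrialState N L}

/-- **(a) Weak Euler–Lagrange equation from minimality.** Let `w` be a measurable pair profile,
`Φ` a real nonnegative, pointwise non-vanishing periodic trial state of finite energy that
MINIMISES the modulated functional `Ψ ↦ E_w(Ψ) + s⟨∑ⱼcos(p·xⱼ)⟩_Ψ` (`p = 2πk/L`) over the
finite-energy periodic trial states, with value `λ = E_w(Φ) + s⟨∑cos⟩_Φ`. Then for every real
`C¹` lattice-periodic Bose-symmetric `ζ`,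
`∫ ∇|Φ|·∇(ζ|Φ|) + ∫ W ζ|Φ|² + s ∫ (∑cos) ζ|Φ|² = λ ∫ ζ|Φ|²` (`W = ∑_{i<j} w^per`, real Bochner
integrals on the cell): the first variation of the Rayleigh quotient along `ε ↦ (1 + εζ)Φ`
vanishes (the quotient of two quadratics in `ε` is minimal at `ε = 0`).
[cite: ReedSimonIV1978, §XIII.1 (Rayleigh–Ritz) and Thm XIII.44] -/
theorem eulerLagrange_of_isMinimiser (hL : 0 < L) (hw : Measurable w)
    (hreal : ∀ X, Φ.ψ X = (‖Φ.ψ X‖ : ℂ)) (hpos : ∀ X, Φ.ψ X ≠ 0) (hfin : periodicEnergy w Φ ≠ ⊤)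
    (k : Fin 3 → ℤ) (s : ℝ)
    (hmin : ∀ Ψ : PeriodicTrialState N L, periodicEnergy w Ψ ≠ ⊤ →
      (periodicEnergy w Φ).toReal + s * cosMean L k Φ ≤
        (periodicEnergy w Ψ).toReal + s * cosMean L k Ψ)
    {ζ : Config N → ℝ} (hζ : ContDiff ℝ 1 ζ) (hζper : IsLatticePeriodic L ζ)
    (hζsymm : ∀ (σ : Equiv.Perm (Fin N)) (X : Config N), ζ (X ∘ σ) = ζ X) :
    (∫ X in cellN N L, gradDot (fun Y => ‖Φ.ψ Y‖) (fun Y => ζ Y * ‖Φ.ψ Y‖) X) +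
      (∫ X in cellN N L, (periodicInteraction w L X).toReal * ζ X * ‖Φ.ψ X‖ ^ 2) +
      s * (∫ X in cellN N L,
        (∑ j, Real.cos (2 * Real.pi / L * ∑ i, (k i : ℝ) * X j i)) * ζ X * ‖Φ.ψ X‖ ^ 2) =
    ((periodicEnergy w Φ).toReal + s * cosMean L k Φ) * ∫ X in cellN N L, ζ X * ‖Φ.ψ X‖ ^ 2 := by
  -- notation
  set F : Config N → ℝ := fun X => ‖Φ.ψ X‖ with hFdef
  set V : Config N → ℝ := fun X => ∑ j, Real.cos (2 * Real.pi / L * ∑ i, (k i : ℝ) * X j i)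
    with hVdef
  set U : Config N → ℝ := fun X => (periodicInteraction w L X).toReal with hUdef
  set lam : ℝ := (periodicEnergy w Φ).toReal + s * cosMean L k Φ with hlam
  have hF : ContDiff ℝ 1 F := contDiff_norm_of_real Φ hreal
  have hH : ContDiff ℝ 1 fun Y => ζ Y * F Y := hζ.mul hF
  have hVc : Continuous V := by
    simp only [hVdef]
    fun_prop
  -- integrability of the potential terms
  obtain ⟨M, hM0, hM⟩ := exists_bound_on_cellN hζ.continuous L
  have hbdd : ∀ (g : Config N → ℝ), Continuous g → (∀ X ∈ cellN N L, |g X| ≤ M ^ 2 + M) →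
      IntegrableOn (fun X => g X * (U X * F X ^ 2)) (cellN N L) := by
    intro g hg hgb
    refine Integrable.bdd_mul (integrableOn_toReal_interaction_mul_norm_sq (Φ := Φ) hw hfin)
      hg.aestronglyMeasurable (c := M ^ 2 + M) ?_
    rw [ae_restrict_iff' (measurableSet_cellN N L)]
    exact ae_of_all _ fun X hX => by rw [Real.norm_eq_abs]; exact hgb X hX
  have iU0 : IntegrableOn (fun X => U X * F X ^ 2) (cellN N L) :=
    integrableOn_toReal_interaction_mul_norm_sq (Φ := Φ) hw hfin
  have iU1 : IntegrableOn (fun X => U X * ζ X * F X ^ 2) (cellN N L) := by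
    have h := hbdd ζ hζ.continuous fun X hX => (hM X hX).trans (by nlinarith)
    refine h.congr_fun (fun X _ => by ring) (measurableSet_cellN N L)
  have iU2 : IntegrableOn (fun X => U X * ζ X ^ 2 * F X ^ 2) (cellN N L) := by
    have h := hbdd (fun X => ζ X ^ 2) (hζ.continuous.pow 2) fun X hX => by
      rw [abs_pow]; nlinarith [hM X hX, abs_nonneg (ζ X)]
    refine h.congr_fun (fun X _ => by ring) (measurableSet_cellN N L)
  have iV0 : IntegrableOn (fun X => V X * F X ^ 2) (cellN N L) :=
    integrableOn_cellN (hVc.mul (hF.continuous.pow 2)) L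
  have iV1 : IntegrableOn (fun X => V X * ζ X * F X ^ 2) (cellN N L) :=
    integrableOn_cellN ((hVc.mul hζ.continuous).mul (hF.continuous.pow 2)) L
  have iV2 : IntegrableOn (fun X => V X * ζ X ^ 2 * F X ^ 2) (cellN N L) :=
    integrableOn_cellN ((hVc.mul (hζ.continuous.pow 2)).mul (hF.continuous.pow 2)) L
  have i10 : IntegrableOn (fun X => (1 : ℝ) * F X ^ 2) (cellN N L) :=
    integrableOn_cellN (continuous_const.mul (hF.continuous.pow 2)) L
  have i11 : IntegrableOn (fun X => (1 : ℝ) * ζ X * F X ^ 2) (cellN N L) :=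
    integrableOn_cellN ((continuous_const.mul hζ.continuous).mul (hF.continuous.pow 2)) L
  have i12 : IntegrableOn (fun X => (1 : ℝ) * ζ X ^ 2 * F X ^ 2) (cellN N L) :=
    integrableOn_cellN ((continuous_const.mul (hζ.continuous.pow 2)).mul (hF.continuous.pow 2)) L
  -- the value `λ` in real form (`θ ≡ 1`)
  have hΦ1 : ∀ X, Φ.ψ X = (((1 : ℝ) * ‖Φ.ψ X‖ : ℝ) : ℂ) := fun X => by rw [one_mul]; exact hreal X
  have hlam_eq : lam = (∫ X in cellN N L, gradDot F F X) + (∫ X in cellN N L, U X * F X ^ 2) +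
      s * ∫ X in cellN N L, V X * F X ^ 2 := by
    rw [hlam, toReal_periodicEnergy_of_eq_mul hw hreal hpos hfin Φ contDiff_const hΦ1,
      cosMean_of_eq_mul k Φ hΦ1]
    simp only [one_mul, hFdef, hUdef, hVdef]
  -- normalisation `∫ F² = 1`
  have hnorm : ∫ X in cellN N L, (1 : ℝ) * F X ^ 2 = 1 := by
    have h := integral_sq_mul_norm_sq_of_eq_mul Φ hΦ1
    simpa only [one_mul] using h
  -- the admissible perturbations
  obtain ⟨ε₀, hε₀, hpert⟩ := exists_perturbedState hL hreal hpos hζ hζper hζsymm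
  -- the key inequality `λ n(ε) ≤ Q(ε)` for small `ε`, expanded to second order
  have key : ∀ ε : ℝ, |ε| < ε₀ →
      0 ≤ 2 * ε * (((∫ X in cellN N L, gradDot F (fun Y => ζ Y * F Y) X) +
          (∫ X in cellN N L, U X * ζ X * F X ^ 2) + s * (∫ X in cellN N L, V X * ζ X * F X ^ 2)) -
          lam * ∫ X in cellN N L, (1 : ℝ) * ζ X * F X ^ 2) +
        ε ^ 2 * (((∫ X in cellN N L, gradDot (fun Y => ζ Y * F Y) (fun Y => ζ Y * F Y) X) +
          (∫ X in cellN N L, U X * ζ X ^ 2 * F X ^ 2) +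
          s * (∫ X in cellN N L, V X * ζ X ^ 2 * F X ^ 2)) -
          lam * ∫ X in cellN N L, (1 : ℝ) * ζ X ^ 2 * F X ^ 2) := by
    intro ε hε
    obtain ⟨Ψ, c, hc, hΨ⟩ := hpert ε hε
    obtain ⟨hne, hE, hn⟩ := energy_perturbedState hw hreal hpos hfin k s ε hζ Ψ hΨ
    have hminε := hmin Ψ hne
    rw [hE] at hminε
    -- `λ n(ε) ≤ Q(ε)`
    have hnn : 0 ≤ ∫ X in cellN N L, ((1 + ε * ζ X) * ‖Φ.ψ X‖) ^ 2 :=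
      integral_nonneg fun X => sq_nonneg _
    have hkey : lam * ∫ X in cellN N L, ((1 + ε * ζ X) * ‖Φ.ψ X‖) ^ 2 ≤
        (∫ X in cellN N L, gradDot (fun Y => (1 + ε * ζ Y) * ‖Φ.ψ Y‖)
          (fun Y => (1 + ε * ζ Y) * ‖Φ.ψ Y‖) X) +
        (∫ X in cellN N L, (periodicInteraction w L X).toReal * ((1 + ε * ζ X) * ‖Φ.ψ X‖) ^ 2) +
        s * ∫ X in cellN N L, (∑ j, Real.cos (2 * Real.pi / L * ∑ i, (k i : ℝ) * X j i)) *
          ((1 + ε * ζ X) * ‖Φ.ψ X‖) ^ 2 := by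
      have h1 := mul_le_mul_of_nonneg_right hminε hnn
      calc _ ≤ _ := h1
        _ = _ := by rw [mul_comm (c ^ 2), mul_assoc, hn, mul_one]
    -- expand every term to second order in `ε`
    have e1 : ∫ X in cellN N L, ((1 + ε * ζ X) * ‖Φ.ψ X‖) ^ 2 =
        (∫ X in cellN N L, (1 : ℝ) * F X ^ 2) + 2 * ε * (∫ X in cellN N L, (1 : ℝ) * ζ X * F X ^ 2) +
          ε ^ 2 * ∫ X in cellN N L, (1 : ℝ) * ζ X ^ 2 * F X ^ 2 := by
      rw [← integral_mul_perturb_sq ε i10 i11 i12]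
      simp only [one_mul, hFdef]
    rw [e1, integral_gradDot_perturb hζ hF ε L, integral_mul_perturb_sq ε iU0 iU1 iU2,
      integral_mul_perturb_sq ε iV0 iV1 iV2, hnorm] at hkey
    rw [hlam_eq] at hkey ⊢
    nlinarith [hkey]
  have hzero := eq_zero_of_forall_small_quadratic_nonneg hε₀ key
  have h1 : ∫ X in cellN N L, (1 : ℝ) * ζ X * F X ^ 2 = ∫ X in cellN N L, ζ X * F X ^ 2 := by
    simp only [one_mul]
  rw [h1] at hzero
  linarith

end EulerLagrange

/-! ### (b) The ground-state representation from minimality -/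

section GroundStateRepresentation

variable {w : ℝ → ℝ≥0∞} {Φ : PeriodicTrialState N L}

/-- Pointwise `C¹` ground-state identity: `|∇(θF)|² = ∇F·∇(θ²F) + |∇θ|² F²` (no second
derivatives). [folklore] -/
theorem gradDot_mul_self_eq {θ F : Config N → ℝ} {X : Config N} (hθ : DifferentiableAt ℝ θ X)
    (hF : DifferentiableAt ℝ F X) :
    gradDot (fun Y => θ Y * F Y) (fun Y => θ Y * F Y) X =
      gradDot F (fun Y => θ Y ^ 2 * F Y) X + gradDot θ θ X * F X ^ 2 := by
  have h2 : ∀ (i : Fin N) (k : Fin 3), pderiv i k (fun Y => θ Y ^ 2 * F Y) X =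
      θ X ^ 2 * pderiv i k F X + F X * (2 * θ X * pderiv i k θ X) := by
    intro i k
    have hθ2 : DifferentiableAt ℝ (fun Y => θ Y ^ 2) X := hθ.pow 2
    have h := pderiv_fun_mul hθ2 hF i k
    rw [h, pderiv_fun_sq hθ]
  simp only [gradDot, pderiv_fun_mul hθ hF, h2, Finset.sum_mul, ← Finset.sum_add_distrib]
  refine Finset.sum_congr rfl fun i _ => Finset.sum_congr rfl fun k _ => ?_
  ring

/-- **(b) Ground-state representation from minimality.** In the setting of
`eulerLagrange_of_isMinimiser` (`Φ` a positive real finite-energy minimiser of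
`E_w + s⟨∑cos⟩` with value `λ`), every periodic trial state of the form `Ψ = θ|Φ|` with `θ` real
`C¹` lattice-periodic Bose-symmetric satisfies the EXACT identity
`E_w(Ψ) + s⟨∑cos⟩_Ψ = λ + 𝓔_{|Φ|}(θ, θ)`, `𝓔_{|Φ|}(θ,θ) = ∫ |∇θ|²|Φ|² = dirichletFormW L |Φ| θ θ`
(Davies' ground-state transform `⟨θΦ,(H_s - λ)θΦ⟩ = ∫|∇θ|²Φ²`, here for `C¹` data: the pointwise
identity `|∇(θΦ)|² = ∇Φ·∇(θ²Φ) + |∇θ|²Φ²` and (a) tested with `ζ = θ²`).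
[cite: Davies1989, §4.2 Thm 4.2.1 (proof), pp. 109–110] -/
theorem gsRepresentation_of_isMinimiser (hL : 0 < L) (hw : Measurable w)
    (hreal : ∀ X, Φ.ψ X = (‖Φ.ψ X‖ : ℂ)) (hpos : ∀ X, Φ.ψ X ≠ 0) (hfin : periodicEnergy w Φ ≠ ⊤)
    (k : Fin 3 → ℤ) (s : ℝ)
    (hmin : ∀ Ψ : PeriodicTrialState N L, periodicEnergy w Ψ ≠ ⊤ →
      (periodicEnergy w Φ).toReal + s * cosMean L k Φ ≤
        (periodicEnergy w Ψ).toReal + s * cosMean L k Ψ)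
    (Ψ : PeriodicTrialState N L) {θ : Config N → ℝ} (hθ : ContDiff ℝ 1 θ)
    (hθper : IsLatticePeriodic L θ)
    (hθsymm : ∀ (σ : Equiv.Perm (Fin N)) (X : Config N), θ (X ∘ σ) = θ X)
    (hΨ : ∀ X, Ψ.ψ X = ((θ X * ‖Φ.ψ X‖ : ℝ) : ℂ)) :
    (periodicEnergy w Ψ).toReal + s * cosMean L k Ψ =
      (periodicEnergy w Φ).toReal + s * cosMean L k Φ +
        dirichletFormW L (fun X => ‖Φ.ψ X‖) θ θ := by
  have hF : ContDiff ℝ 1 (fun X => ‖Φ.ψ X‖) := contDiff_norm_of_real Φ hreal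
  -- (a) tested with `ζ = θ²`
  have hζ : ContDiff ℝ 1 fun X => θ X ^ 2 := hθ.pow 2
  have hζper : IsLatticePeriodic L fun X => θ X ^ 2 := fun X i a => by
    show θ _ ^ 2 = θ X ^ 2
    rw [hθper X i a]
  have hζsymm : ∀ (σ : Equiv.Perm (Fin N)) (X : Config N),
      (fun X => θ X ^ 2) (X ∘ σ) = (fun X => θ X ^ 2) X := fun σ X => by
    simp only [hθsymm σ X]
  have hEL := eulerLagrange_of_isMinimiser hL hw hreal hpos hfin k s hmin hζ hζper hζsymm
  have hnorm := integral_sq_mul_norm_sq_of_eq_mul Ψ hΨ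
  rw [toReal_periodicEnergy_of_eq_mul hw hreal hpos hfin Ψ hθ hΨ, cosMean_of_eq_mul k Ψ hΨ]
  -- the kinetic identity, integrated
  have hkin : ∫ X in cellN N L, gradDot (fun Y => θ Y * ‖Φ.ψ Y‖) (fun Y => θ Y * ‖Φ.ψ Y‖) X =
      (∫ X in cellN N L, gradDot (fun Y => ‖Φ.ψ Y‖) (fun Y => θ Y ^ 2 * ‖Φ.ψ Y‖) X) +
        dirichletFormW L (fun X => ‖Φ.ψ X‖) θ θ := by
    unfold dirichletFormW
    rw [← integral_add (integrableOn_cellN (continuous_gradDot hF (hζ.mul hF)) L)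
      (integrableOn_gradDot_mul_sq hF.continuous hθ hθ L)]
    refine integral_congr_ae (ae_of_all _ fun X => ?_)
    exact gradDot_mul_self_eq (hθ.differentiable one_ne_zero X) (hF.differentiable one_ne_zero X)
  have hsq : ∀ X, (θ X * ‖Φ.ψ X‖) ^ 2 = θ X ^ 2 * ‖Φ.ψ X‖ ^ 2 := fun X => by ring
  simp_rw [hsq] at hnorm ⊢
  rw [hnorm, mul_one] at hEL
  rw [hkin]
  have e1 : ∫ X in cellN N L, (periodicInteraction w L X).toReal * (θ X ^ 2 * ‖Φ.ψ X‖ ^ 2) =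
      ∫ X in cellN N L, (periodicInteraction w L X).toReal * θ X ^ 2 * ‖Φ.ψ X‖ ^ 2 := by
    congr 1 with X; ring
  have e2 : ∫ X in cellN N L, (∑ j, Real.cos (2 * Real.pi / L * ∑ i, (k i : ℝ) * X j i)) *
        (θ X ^ 2 * ‖Φ.ψ X‖ ^ 2) =
      ∫ X in cellN N L, (∑ j, Real.cos (2 * Real.pi / L * ∑ i, (k i : ℝ) * X j i)) *
        θ X ^ 2 * ‖Φ.ψ X‖ ^ 2 := by
    congr 1 with X; ring
  rw [e1, e2]
  linarith [hEL]

/-- **Ground-state representation for a pair of real nonnegative states.** If `Φ` is a positive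
real finite-energy minimiser of `E_w + s⟨∑cos⟩` (value `λ`) and `Ψ` is ANY real nonnegative
periodic trial state, then with `θ = |Ψ|/|Φ|` (`C¹`, periodic, symmetric):
`E_w(Ψ) + s⟨∑cos⟩_Ψ = λ + ∫ |∇(|Ψ|/|Φ|)|² |Φ|²`; in particular `E_w(Ψ) < ∞`.
[cite: Davies1989, §4.2 Thm 4.2.1 (proof), pp. 109–110] -/
theorem gsRepresentation_of_real (hL : 0 < L) (hw : Measurable w)
    (hreal : ∀ X, Φ.ψ X = (‖Φ.ψ X‖ : ℂ)) (hpos : ∀ X, Φ.ψ X ≠ 0) (hfin : periodicEnergy w Φ ≠ ⊤)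
    (k : Fin 3 → ℤ) (s : ℝ)
    (hmin : ∀ Ψ : PeriodicTrialState N L, periodicEnergy w Ψ ≠ ⊤ →
      (periodicEnergy w Φ).toReal + s * cosMean L k Φ ≤
        (periodicEnergy w Ψ).toReal + s * cosMean L k Ψ)
    (Ψ : PeriodicTrialState N L) (hrealΨ : ∀ X, Ψ.ψ X = (‖Ψ.ψ X‖ : ℂ)) :
    periodicEnergy w Ψ ≠ ⊤ ∧
    (periodicEnergy w Ψ).toReal + s * cosMean L k Ψ =
      (periodicEnergy w Φ).toReal + s * cosMean L k Φ +
        dirichletFormW L (fun X => ‖Φ.ψ X‖) (fun X => ‖Ψ.ψ X‖ / ‖Φ.ψ X‖)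
          (fun X => ‖Ψ.ψ X‖ / ‖Φ.ψ X‖) := by
  have hF : ContDiff ℝ 1 (fun X => ‖Φ.ψ X‖) := contDiff_norm_of_real Φ hreal
  have hG : ContDiff ℝ 1 (fun X => ‖Ψ.ψ X‖) := contDiff_norm_of_real Ψ hrealΨ
  have hF0 : ∀ X, ‖Φ.ψ X‖ ≠ 0 := fun X => norm_ne_zero_iff.2 (hpos X)
  have hθ : ContDiff ℝ 1 fun X => ‖Ψ.ψ X‖ / ‖Φ.ψ X‖ := hG.div hF hF0
  have hθper : IsLatticePeriodic L fun X => ‖Ψ.ψ X‖ / ‖Φ.ψ X‖ := fun X i a => by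
    simp only [Ψ.periodic X i a, Φ.periodic X i a]
  have hθsymm : ∀ (σ : Equiv.Perm (Fin N)) (X : Config N),
      (fun X => ‖Ψ.ψ X‖ / ‖Φ.ψ X‖) (X ∘ σ) = (fun X => ‖Ψ.ψ X‖ / ‖Φ.ψ X‖) X := fun σ X => by
    simp only [Ψ.symm σ X, Φ.symm σ X]
  have hΨ : ∀ X, Ψ.ψ X = (((‖Ψ.ψ X‖ / ‖Φ.ψ X‖) * ‖Φ.ψ X‖ : ℝ) : ℂ) := fun X => by
    rw [div_mul_cancel₀ _ (hF0 X)]; exact hrealΨ X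
  exact ⟨periodicEnergy_ne_top_of_eq_mul hw hreal hpos hfin Ψ hθ hΨ,
    gsRepresentation_of_isMinimiser hL hw hreal hpos hfin k s hmin Ψ hθ hθper hθsymm hΨ⟩

end GroundStateRepresentation

/-- **Registered form (sub-goal `stub_modulationGroundStateRepresentation` of stub S3).** The
ground-state representation from minimality, (b), as a closed statement
(`gsRepresentation_of_isMinimiser`). [cite: Davies1989, §4.2 Thm 4.2.1 (proof), pp. 109–110] -/
theorem stub_modulationGroundStateRepresentation :
    ∀ (w : ℝ → ℝ≥0∞), Measurable w → ∀ (N : ℕ) (L : ℝ), 0 < L → ∀ (k : Fin 3 → ℤ) (s : ℝ)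
      (Φ Ψ : PeriodicTrialState N L) (θ : Config N → ℝ), (∀ X, Φ.ψ X = (‖Φ.ψ X‖ : ℂ)) →
      (∀ X, Φ.ψ X ≠ 0) → periodicEnergy w Φ ≠ ⊤ →
      (∀ Ψ' : PeriodicTrialState N L, periodicEnergy w Ψ' ≠ ⊤ →
        (periodicEnergy w Φ).toReal + s * cosMean L k Φ ≤
          (periodicEnergy w Ψ').toReal + s * cosMean L k Ψ') →
      ContDiff ℝ 1 θ → IsLatticePeriodic L θ →
      (∀ (σ : Equiv.Perm (Fin N)) (X : Config N), θ (X ∘ σ) = θ X) →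
      (∀ X, Ψ.ψ X = ((θ X * ‖Φ.ψ X‖ : ℝ) : ℂ)) →
      (periodicEnergy w Ψ).toReal + s * cosMean L k Ψ =
        (periodicEnergy w Φ).toReal + s * cosMean L k Φ + dirichletFormW L (fun X => ‖Φ.ψ X‖) θ θ :=
  fun _w hw _N _L hL k s _Φ Ψ _θ hreal hpos hfin hmin hθ hθper hθsymm hΨ =>
    gsRepresentation_of_isMinimiser hL hw hreal hpos hfin k s hmin Ψ hθ hθper hθsymm hΨ

end Summit.AtomisticToContinuum.BoseEinsteinCondensation.Cruxes.StaticResponseBound.UvThomsonForceWave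

end
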